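/-
Copyright: b2b-lace packet (Lean typing seat 1, gen 42).  [FvdH17] §4.2 (4.17) with an EXACT FIRST line,
`𝓣_{1̲,m₂,m₃}(v,y,x)`: the exact bond `(0,v)` is the pinned first edge of the coded trail, so the (5.40)-type
extraction of [NoBLE17] §5.3.2 applies with line indices `(1 + m₂, m₃)`, junction `y`, LINEAR multiplicity
`L + 1 − (1 + m₂) − m₃`, the two remainder slots of the repulsive bubble, and the out-point `v = W(1)` DETERMINED by the
index — node EXL-XSLOT, leaf XSLOT-F (first exact leg) of the cell's N76 map.  Proofs only; no named fact; no
dimension.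
-/
import Literature.Probability.FitznerVanDerHofstad2017.RepulsiveTriangleExtractionIndep
import Literature.Probability.FitznerVanDerHofstad2017.NobleBubbleLetterSums
import Literature.Probability.FitznerVanDerHofstad2017.NobleElementsClosedFormsPerc
import Literature.Probability.FitznerVanDerHofstad2017.NobleEntryAiotaPrimeZeroZero
import HarnessLib

/-!
# [FvdH17] (4.17) with an exact first bond: the trail-level extraction at linear multiplicity

For the instance `Letters.perc d p` of the NoBLE letters, the repulsive triangle letter with an exact-one-bond FIRST
line, `𝓣_{1̲,m₂,m₃}(v,y,x) = max_c ℙ_p^{⊗3}({0 –1̲– v}_{c₀} ⊛ {v ←m₂→ y}_{c₁} ⊛ {y ←m₃→ x}_{c₂})`, summed over the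
out-point `v` (in the blocks `v = e_κ` is a neighbour of `0`, summed over `κ`) and the junction `y`, is bounded by the
right-hand side of [NoBLE17] (5.40) at line indices `(1 + m₂, m₃)` with the junction read at `y`:

* **Coding** (`exists_trail_of_mem_genDisjOcc_lineEvents₃_eqOne₁`): the witness of the exact line is the single bond
  `(0,v)`; restricting the three levels to the witness sets and applying the landed triangle coding
  `exists_trail_of_mem_genDisjConnN_triLines` at `(1, m₂, m₃)` yields ONE bond-self-avoiding word `W` of length `L`
  with `W(1) = v`, `W(r) = y` (`1 + m₂ ≤ r`, `r + m₃ ≤ L`), `W(L) = x`, the arcs `[0,1)`, `[1,r)`, `[r,L)` open on the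
  levels `c₀, c₁, c₂` — the first arc has exactly one edge because a trail has `#arc = length` (`IsTrail.card_wordArc`).
* **Extraction** (`mem_boxes_of_trail_eqOne₁`): cut at `M` exactly as in (5.40) with line indices `(1 + m₂, m₃)` and
  junction `y` at position `r` — explicit (`L < M`), one-tail (`r < M − m₃`), two-tail (`r ≥ M − m₃`; `1 + m₃ ≤ M`);
  the boxes are the landed labelled boxes `piecesE W 1 r`, `piecesO u 1 r x`, `piecesT2 u₁ 1 u₃ x y`, so the landed
  membership and measure lemmas (`mem_box*_of_trail`, `piReal_box*_le`: independence across levels × BK within) are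
  used verbatim; the index of a box is the (5.40) index (`idxExplicitB ⊔ idxOneTailB ⊔ idxTwoTail` at `(1+m₂, m₃)`),
  and the out-point `v = W(1)` is DETERMINED by it (the first letter of `W`, `u`, resp. `u₁`).
* **Summation** (`piReal_genDisjOcc_lineEvents₃_eqOne₁_le`, `sum_perc_T_eqOne_ge_ge_toReal_le_extraction`,
  `sum_sum_perc_T_eqOne_ge_ge_toReal_le_slots`, `tsum_tsum_perc_T_eqOne_ge_ge_le_ofReal`,
  `tsum_sum_perc_T_eqOne_ge_ge_stepVec_le_ofReal`, cells `perc_matAbarIota'_zero_zero_le_xslot` (and its three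
  primed `(0,0)` twins), `perc_matAiota_one_zero_le_xslot`): the sum over the out-point is fiberwise over the
  determined first letter, then the landed `sum_le_extraction_of_pointwise` and `sum_le_repBubble_slots` give
  `Σ_{v∈S₁} Σ_{y∈S₂} 𝓣_{1̲,m₂,m₃}(v,y,x) ≤ Σ_{L∈[1+m₂+m₃, M)} (L−m₂−m₃)·a_L(x)·p^L + (M−1−m₂−m₃)·p^M Γ̄₂ R₁ + p^M Γ̄₂² R₂`
  (`R₁` valid for `[M]`, `R₂` for `[M−m₃, m₃]` on the endpoint set), i.e. `bubbleSlotR p Γ̄₂ (1+m₂) m₃ M N R₁ R₂` —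
  for ALL out-points `v ∈ ℤ^d`, which dominates the `Σ_κ`, `v = e_κ`, form of the blocks (`stepVec` is injective).
* **Both first lines exact** (`exists_trail_of_mem_genDisjOcc_lineEvents₃_eqOne₁_eqOne₂`,
  `piReal_genDisjOcc_lineEvents₃_eqOne₁_eqOne₂_le`, `sum_sum_perc_T_eqOne_eqOne_ge_toReal_le_slots`,
  `tsum_tsum_perc_T_eqOne_eqOne_ge_le_ofReal`, `tsum_sum_perc_T_eqOne_eqOne_ge_stepVec_le_ofReal`): for
  `𝓣_{1̲,1̲,m₃}(v,y,x)` the junction is PINNED at position `2`, so the same extraction runs at MULTIPLICITY ONE: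
  `Σ_{v∈S₁} Σ_{y∈S₂} 𝓣_{1̲,1̲,m₃}(v,y,x) ≤ Σ_{L∈[2+m₃, M)} a_L(x)·p^L + p^M Γ̄₂ R₁ + p^M Γ̄₂² R₂` (`2 + m₃ ≤ M`).

## References
* [FvdH17] R. Fitzner, R. van der Hofstad, Mean-field behavior for nearest-neighbor percolation in `d > 10`,
  Electron. J. Probab. 22 (2017) no. 43; arXiv:1506.07977v2 — §4.2 Def. 4.1, (4.16)–(4.18) and the display after (4.18)
  (v2 pp. 34–36 = EJP p. 33); App. B Table B.4 row (1,0) (p. 74); §6.1 case `a = b = 0` (p. 59).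
* [NoBLE17] R. Fitzner, R. van der Hofstad, Generalized approach to the non-backtracking lace expansion,
  Probab. Theory Relat. Fields 169 (2017) 1041–1119 — §5.3.1 (5.35)–(5.38) p. 1097, §5.3.2 (5.40)–(5.41) p. 1098.
-/

noncomputable section

namespace Literature.Probability.FitznerVanDerHofstad2017.NobleBlocks

open _root_.MeasureTheory Finset
open scoped BigOperators ENNReal
open Literature.Probability.LatticeModels Literature.Probability.Percolation
open Literature.Barriers.CriticalPhenomena
open Literature.Probability.FitznerVanDerHofstad2017
open Literature.Probability.FitznerVanDerHofstad2017.NobleBlocks.LenIdx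

variable {d : ℕ}

/-! ## A. Coding: the exact first bond is the first edge of the trail -/

/-- **Coding of a member of `𝓣_{1̲,m₂,m₃}(v,y,x)`.**  If `ω ∈ {0 –1̲– v}_{c₀} ⊛ {v ←m₂→ y}_{c₁} ⊛ {y ←m₃→ x}_{c₂}`
(lattice configurations), there is ONE bond-self-avoiding word `W` of length `L` with `W(1) = v`, `W(r) = y`,
`W(L) = x` (`1 + m₂ ≤ r`, `r + m₃ ≤ L`), the bond `[0,1)` in `ω_{c₀}`, the arc `[1,r)` open in `ω_{c₁}`, the arc
`[r,L)` in `ω_{c₂}`: the landed triangle coding applied to the witness sets, the first witness shrunk to the bond.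
[cite: FitznerVanDerHofstad2017, §4.2 Def. 4.1, (4.17) (arXiv:1506.07977v2 pp. 35–36 = EJP p. 33)]
[cite: FitznerVanDerHofstad2016NoBLE, §5.3.1 (5.35) PTRF p. 1097] -/
theorem exists_trail_of_mem_genDisjOcc_lineEvents₃_eqOne₁ {k : ℕ} {c : Fin 3 → Fin k}
    {ω : Fin k → BondConfig (Site d)} (hω : ∀ j, ω j ⊆ (zdGraph d).edgeSet) {m₂ m₃ : ℕ} {v y x : Site d}
    (h : ω ∈ genDisjOcc (lineEvents₃ (eq 1) (ge m₂) (ge m₃) v y x) c) :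
    ∃ (L r : ℕ) (W : Fin L → Fin d × Bool), IsTrail W ∧ 1 + m₂ ≤ r ∧ r + m₃ ≤ L ∧
      wordPos W 1 = v ∧ wordPos W r = y ∧ wordPos W L = x ∧
      (↑(wordArc W 0 1) : Set (Sym2 (Site d))) ⊆ ω (c 0) ∧
        (↑(wordArc W 1 r) : Set (Sym2 (Site d))) ⊆ ω (c 1) ∧
          (↑(wordArc W r L) : Set (Sym2 (Site d))) ⊆ ω (c 2) := by
  classical
  obtain ⟨K, hKω, hKA, hdisj⟩ := h
  have hA0 : K 0 ∈ (openConnEq 1 (0 : Site d) v : Set (BondConfig (Site d))) := by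
    simpa [lineEvents₃] using hKA 0
  have hA1 : K 1 ∈ (openConnGe m₂ v y : Set (BondConfig (Site d))) := by simpa [lineEvents₃] using hKA 1
  have hA2 : K 2 ∈ (openConnGe m₃ y x : Set (BondConfig (Site d))) := by simpa [lineEvents₃] using hKA 2
  obtain ⟨h0v, hb⟩ := (mem_openConnEq_one_iff (0 : Site d) v (K 0)).1 hA0
  have hb1 : s((0 : Site d), v) ∉ K 1 := fun h' =>
    Set.disjoint_left.1 (hdisj (show (0 : Fin 3) ≠ 1 by decide)) hb h'
  have hb2 : s((0 : Site d), v) ∉ K 2 := fun h' =>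
    Set.disjoint_left.1 (hdisj (show (0 : Fin 3) ≠ 2 by decide)) hb h'
  -- the witness configurations on three levels, the first one shrunk to the bond
  let ω' : Fin 3 → BondConfig (Site d) := ![{s((0 : Site d), v)}, K 1, K 2]
  have hω'0 : ω' 0 = {s((0 : Site d), v)} := rfl
  have hω'1 : ω' 1 = K 1 := rfl
  have hω'2 : ω' 2 = K 2 := rfl
  have hω'lat : ∀ j, ω' j ⊆ (zdGraph d).edgeSet := by
    intro j
    fin_cases j
    · show ({s((0 : Site d), v)} : Set (Sym2 (Site d))) ⊆ _
      exact Set.singleton_subset_iff.2 (hω _ (hKω 0 hb))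
    · exact (hKω 1).trans (hω _)
    · exact (hKω 2).trans (hω _)
  have hmem : ω' ∈ genDisjConnN (triLines (fun i : Fin 3 => i) 1 m₂ m₃ v y x) := by
    refine ⟨fun i => ω' i, fun i => ?_, fun i => ?_, ?_⟩
    · fin_cases i <;> simp [triLines]
    · fin_cases i
      · simpa [triLines, GDLine.event, hω'0] using
          openConnEq_subset_openConnGe 1 (0 : Site d) v
            ((mem_openConnEq_one_iff (0 : Site d) v ({s((0 : Site d), v)} : Set (Sym2 (Site d)))).2
              ⟨h0v, Set.mem_singleton _⟩)
      · simpa [triLines, GDLine.event, hω'1] using hA1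
      · simpa [triLines, GDLine.event, hω'2] using hA2
    · intro i j hij
      fin_cases i <;> fin_cases j
      · exact absurd rfl hij
      · simpa [hω'0, hω'1] using hb1
      · simpa [hω'0, hω'2] using hb2
      · simpa [hω'0, hω'1] using hb1
      · exact absurd rfl hij
      · simpa [hω'1, hω'2] using hdisj (show (1 : Fin 3) ≠ 2 by decide)
      · simpa [hω'0, hω'2] using hb2
      · simpa [hω'1, hω'2] using hdisj (show (2 : Fin 3) ≠ 1 by decide)
      · exact absurd rfl hij
  obtain ⟨L, r₁, r₂, W, hW, hr₁, hr₁₂, hr₂L, hv, hy, hx, h0, h1, h2⟩ :=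
    exists_trail_of_mem_genDisjConnN_triLines hω'lat hmem
  -- the first arc is the single bond: a trail has `r₁` distinct edges there, all equal to `(0,v)`
  have hcard : (wordArc W 0 r₁).card ≤ 1 := by
    have hsub : wordArc W 0 r₁ ⊆ {s((0 : Site d), v)} := by
      intro e he
      have := h0 (Finset.mem_coe.2 he)
      simpa [hω'0] using this
    simpa using Finset.card_le_card hsub
  rw [hW.card_wordArc (by omega)] at hcard
  have hr₁' : r₁ = 1 := by omega
  subst hr₁'
  refine ⟨L, r₂, W, hW, hr₁₂, hr₂L, hv, hy, hx, ?_, ?_, ?_⟩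
  · refine h0.trans ?_
    rw [hω'0]
    exact Set.singleton_subset_iff.2 (hKω 0 hb)
  · exact h1.trans (by rw [hω'1]; exact hKω 1)
  · exact h2.trans (by rw [hω'2]; exact hKω 2)

/-! ## B. Extraction: an open labelled trail with its pinned first bond lies in one of the (5.40) boxes -/

section Extraction

variable {k : ℕ} (c : Fin 3 → Fin k)

/-- **Extraction with a pinned first bond** (the three cases of (5.40) at line indices `(1 + m₂, m₃)`, junction `y`
at position `r`, the out-point `v = W(1)` determined): an open labelled trail lies in the labelled box of an EXPLICIT
index (`L < M`: arcs `[0,1)`, `[1,r)`, `[r,L)`), of a ONE-TAIL index (`r < M − m₃`: the arcs of `W|[0,M)` and the tail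
`{W(M) ↔ x}`), or of a TWO-TAIL index (`r ≥ M − m₃`: `W|[0,M−m₃)` — which contains the bond since `1 + m₃ ≤ M` — and
its tail to `y` on lines 1–2, the next `m₃` bonds and the tail to `x` on line 3).
[cite: FitznerVanDerHofstad2016NoBLE, §5.3.1 (5.38) p. 1097, §5.3.2 (5.40)–(5.41) p. 1098]
[cite: FitznerVanDerHofstad2017, §4.2, display after (4.18) (arXiv:1506.07977v2 p. 36 = EJP p. 33)] -/
theorem mem_boxes_of_trail_eqOne₁ (m₂ m₃ M : ℕ) (hM : 1 + m₃ ≤ M) {ω : Fin k → BondConfig (Site d)} {L r : ℕ}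
    {v y x : Site d} {W : Fin L → Fin d × Bool} (hW : IsTrail W) (hr : 1 + m₂ ≤ r) (hrL : r + m₃ ≤ L)
    (hv : wordPos W 1 = v) (hy : wordPos W r = y) (hx : wordPos W L = x)
    (h0 : (↑(wordArc W 0 1) : Set (Sym2 (Site d))) ⊆ ω (c 0))
    (h1 : (↑(wordArc W 1 r) : Set (Sym2 (Site d))) ⊆ ω (c 1))
    (h2 : (↑(wordArc W r L) : Set (Sym2 (Site d))) ⊆ ω (c 2)) :
    (∃ LW ∈ idxExplicitB (1 + m₂) m₃ M x y,
        LW.2.2 = r ∧ wordPos LW.2.1 1 = v ∧ ω ∈ boxOf (piecesE LW.2.1 1 LW.2.2) labE c) ∨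
      (∃ ur ∈ idxOneTailB (d := d) (1 + m₂) m₃ M y,
          ur.2 = r ∧ wordPos ur.1 1 = v ∧ ω ∈ boxOf (piecesO ur.1 1 ur.2 x) labO c) ∨
        ∃ uu ∈ idxTwoTail (d := d) m₃ M,
          wordPos uu.1 1 = v ∧ ω ∈ boxOf (piecesT2 uu.1 1 uu.2 x y) labT2 c := by
  classical
  by_cases hLM : L < M
  · refine Or.inl ⟨⟨L, (W, r)⟩, ?_, rfl, hv, ?_⟩
    · simp only [idxExplicitB, Finset.mem_sigma, Finset.mem_filter, Finset.mem_product, mem_trailWordsTo,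
        Finset.mem_Ico, Finset.mem_Icc]
      exact ⟨⟨by omega, hLM⟩, ⟨⟨hW, hx⟩, hr, by omega⟩, hy⟩
    · show ω ∈ boxOf (piecesE W 1 r) labE c
      exact mem_boxE_of_trail c hW (by omega) (by omega) h0 h1 h2
  · replace hLM : M ≤ L := not_lt.1 hLM
    by_cases hrM : r < M - m₃
    · refine Or.inr (Or.inl ⟨(wordTake W M hLM, r), ?_, rfl, ?_,
        mem_boxO_of_trail c hW hLM (by omega) (by omega) hx h0 h1 h2⟩)
      · rw [idxOneTailB, Finset.mem_filter, Finset.mem_product, mem_trailWords, Finset.mem_Ico]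
        exact ⟨⟨hW.wordTake hLM, hr, hrM⟩, by rw [wordPos_wordTake W hLM (by omega), hy]⟩
      · show wordPos (wordTake W M hLM) 1 = v
        rw [wordPos_wordTake W hLM (by omega), hv]
    · replace hrM : M - m₃ ≤ r := not_lt.1 hrM
      have hML : M - m₃ ≤ L := by omega
      refine Or.inr (Or.inr ⟨(wordTake W (M - m₃) hML, wordSeg W r m₃ hrL), ?_, ?_,
        mem_boxT2_of_trail c hW (by omega) hrM hrL hML hy hx h0 h1 h2⟩)
      · rw [idxTwoTail, Finset.mem_product, mem_trailWords, mem_trailWords]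
        exact ⟨hW.wordTake hML, hW.wordSeg hrL⟩
      · show wordPos (wordTake W (M - m₃) hML) 1 = v
        rw [wordPos_wordTake W hML (by omega), hv]

end Extraction

/-! ## C. The pointwise bound of a member, the out-point determined by the index -/

section Pointwise

variable {k : ℕ}

/-- **(4.17) with an exact first bond, member `c`, pointwise in `(v,y)`, by extraction**:
`ℙ_p^{⊗k}({0 –1̲– v}_{c₀} ⊛ {v ←m₂→ y}_{c₁} ⊛ {y ←m₃→ x}_{c₂})` is at most the sum of the (5.40) values (junction `y`,
line indices `(1+m₂, m₃)`) over the indices whose first letter points to `v`: configurations off the lattice are null;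
on the lattice the coded trail lies in a box (`mem_boxes_of_trail_eqOne₁`) whose measure is the value
(`piReal_boxE_le`, `piReal_boxO_le`, `piReal_boxT2_le`).
[cite: FitznerVanDerHofstad2016NoBLE, §5.3.2 (5.40)–(5.41) PTRF p. 1098]
[cite: FitznerVanDerHofstad2017, §4.2 (4.17) and the display after (4.18) (arXiv:1506.07977v2 p. 36 = EJP p. 33)] -/
theorem piReal_genDisjOcc_lineEvents₃_eqOne₁_le (c : Fin 3 → Fin k) (p : unitInterval) (m₂ m₃ M : ℕ)
    (hM : 1 + m₃ ≤ M) (x v y : Site d) :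
    (Measure.pi (fun _ : Fin k => bondPercolation (zdGraph d) p)).real
        (genDisjOcc (lineEvents₃ (eq 1) (ge m₂) (ge m₃) v y x) c) ≤
      (∑ LW ∈ (idxExplicitB (1 + m₂) m₃ M x y).filter (fun LW => wordPos LW.2.1 1 = v), (p : ℝ) ^ LW.1) +
        (∑ ur ∈ (idxOneTailB (d := d) (1 + m₂) m₃ M y).filter (fun ur => wordPos ur.1 1 = v),
            (p : ℝ) ^ M * tau d p (wordPos ur.1 M) x) +
          ∑ uu ∈ (idxTwoTail (d := d) m₃ M).filter (fun uu => wordPos uu.1 1 = v),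
            (p : ℝ) ^ (M - m₃) * (p : ℝ) ^ m₃ *
              (tau d p (wordPos uu.1 (M - m₃)) y * tau d p (y + wordPos uu.2 m₃) x) := by
  classical
  set μ := bondPercolation (zdGraph d) p with hμ
  set ν : Measure (Fin k → BondConfig (Site d)) := Measure.pi (fun _ : Fin k => μ) with hν
  set T : Set (Fin k → BondConfig (Site d)) := genDisjOcc (lineEvents₃ (eq 1) (ge m₂) (ge m₃) v y x) c with hT
  set IE := (idxExplicitB (1 + m₂) m₃ M x y).filter (fun LW => wordPos LW.2.1 1 = v) with hIE
  set IO := (idxOneTailB (d := d) (1 + m₂) m₃ M y).filter (fun ur => wordPos ur.1 1 = v) with hIO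
  set IT := (idxTwoTail (d := d) m₃ M).filter (fun uu => wordPos uu.1 1 = v) with hIT
  set UE : Set (Fin k → BondConfig (Site d)) := ⋃ LW ∈ IE, boxOf (piecesE LW.2.1 1 LW.2.2) labE c with hUE
  set UO : Set (Fin k → BondConfig (Site d)) := ⋃ ur ∈ IO, boxOf (piecesO ur.1 1 ur.2 x) labO c with hUO
  set UT : Set (Fin k → BondConfig (Site d)) := ⋃ uu ∈ IT, boxOf (piecesT2 uu.1 1 uu.2 x y) labT2 c with hUT
  set bad : Set (Fin k → BondConfig (Site d)) :=
    ⋃ j : Fin k, Function.eval j ⁻¹' {ω | ¬ ω ⊆ (zdGraph d).edgeSet} with hbad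
  have h0 : μ {ω | ¬ ω ⊆ (zdGraph d).edgeSet} = 0 := by
    have := ProbabilityTheory.setBernoulli_ae_subset (u := (zdGraph d).edgeSet) (p := p)
    rw [Filter.Eventually, mem_ae_iff, Set.compl_setOf] at this
    exact this
  have hbad0 : ν.real bad = 0 := by
    rw [measureReal_def, measure_iUnion_null fun j => ?_, ENNReal.toReal_zero]
    exact Measure.pi_eval_preimage_null (fun _ : Fin k => μ) h0
  -- the covering
  have hcov : T ⊆ bad ∪ (UE ∪ UO ∪ UT) := by
    intro ω hω
    by_cases hb : ∀ j, ω j ⊆ (zdGraph d).edgeSet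
    · right
      obtain ⟨L, r, W, hW, hr, hrL, hv, hy, hx, hW0, hW1, hW2⟩ :=
        exists_trail_of_mem_genDisjOcc_lineEvents₃_eqOne₁ hb hω
      rcases mem_boxes_of_trail_eqOne₁ c m₂ m₃ M hM hW hr hrL hv hy hx hW0 hW1 hW2 with
        ⟨LW, hLW, -, hLWv, hωE⟩ | ⟨ur, hur, -, hurv, hωO⟩ | ⟨uu, huu, huuv, hωT⟩
      · exact Or.inl (Or.inl (Set.mem_iUnion₂.2 ⟨LW, Finset.mem_filter.2 ⟨hLW, hLWv⟩, hωE⟩))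
      · exact Or.inl (Or.inr (Set.mem_iUnion₂.2 ⟨ur, Finset.mem_filter.2 ⟨hur, hurv⟩, hωO⟩))
      · exact Or.inr (Set.mem_iUnion₂.2 ⟨uu, Finset.mem_filter.2 ⟨huu, huuv⟩, hωT⟩)
    · left
      obtain ⟨j, hj⟩ := not_forall.1 hb
      exact Set.mem_iUnion.2 ⟨j, hj⟩
  -- the measure of each box
  have hE : ν.real UE ≤ ∑ LW ∈ IE, (p : ℝ) ^ LW.1 := by
    refine (measureReal_biUnion_finset_le _ _).trans (Finset.sum_le_sum fun LW hLW => ?_)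
    have hi := (Finset.mem_filter.1 hLW).1
    simp only [idxExplicitB, Finset.mem_sigma, Finset.mem_filter, Finset.mem_product, mem_trailWordsTo,
      Finset.mem_Ico, Finset.mem_Icc] at hi
    exact piReal_boxE_le c p hi.2.1.1.1 (by omega) (by omega)
  have hO : ν.real UO ≤ ∑ ur ∈ IO, (p : ℝ) ^ M * tau d p (wordPos ur.1 M) x := by
    refine (measureReal_biUnion_finset_le _ _).trans (Finset.sum_le_sum fun ur hur => ?_)
    have hi := (Finset.mem_filter.1 hur).1
    simp only [idxOneTailB, Finset.mem_filter, Finset.mem_product, mem_trailWords, Finset.mem_Ico] at hi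
    exact piReal_boxO_le c p hi.1.1 (by omega) (by omega) x
  have hT2 : ν.real UT ≤ ∑ uu ∈ IT, (p : ℝ) ^ (M - m₃) * (p : ℝ) ^ m₃ *
      (tau d p (wordPos uu.1 (M - m₃)) y * tau d p (y + wordPos uu.2 m₃) x) := by
    refine (measureReal_biUnion_finset_le _ _).trans (Finset.sum_le_sum fun uu huu => ?_)
    have hi := (Finset.mem_filter.1 huu).1
    simp only [idxTwoTail, Finset.mem_product, mem_trailWords] at hi
    exact piReal_boxT2_le c p hi.1 hi.2 (by omega) x y
  calc ν.real T ≤ ν.real (bad ∪ (UE ∪ UO ∪ UT)) := measureReal_mono hcov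
    _ ≤ ν.real bad + ν.real (UE ∪ UO ∪ UT) := measureReal_union_le _ _
    _ ≤ 0 + (ν.real UE + ν.real UO + ν.real UT) := by
        refine add_le_add hbad0.le ((measureReal_union_le _ _).trans ?_)
        exact add_le_add (measureReal_union_le _ _) le_rfl
    _ ≤ _ := by rw [zero_add]; exact add_le_add (add_le_add hE hO) hT2

/-- `ℙ_p^{⊗3}` of the instance's letters is the product Bernoulli measure of `piReal_genDisjOcc_lineEvents₃_eqOne₁_le`,
in `ℝ≥0∞`. [cite: FitznerVanDerHofstad2017, §4.2 (4.17) (arXiv:1506.07977v2 p. 36)] -/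
theorem piPerc_genDisjOcc_lineEvents₃_eqOne_ge_ge_eq_ofReal (p : unitInterval) (c : Fin 3 → Fin 3) (m₂ m₃ : ℕ)
    (v y x : Site d) :
    piPerc d p 3 (genDisjOcc (lineEvents₃ (eq 1) (ge m₂) (ge m₃) v y x) c) =
      ENNReal.ofReal ((Measure.pi (fun _ : Fin 3 => bondPercolation (zdGraph d) p)).real
        (genDisjOcc (lineEvents₃ (eq 1) (ge m₂) (ge m₃) v y x) c)) := by
  rw [piPerc, ofReal_measureReal (measure_ne_top _ _)]

end Pointwise

/-! ## D. The letter `𝓣_{1̲,m₂,m₃}` of the instance: maximum over the assignments, slots, `∑'` -/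

section Letter

variable (p : unitInterval)

/-- **`𝓣_{1̲,m₂,m₃}(v,y,x)` pointwise by extraction** (every member of the maximum obeys
`piReal_genDisjOcc_lineEvents₃_eqOne₁_le`, whose right-hand side does not depend on the assignment).
[cite: FitznerVanDerHofstad2017, §4.2 (4.17) (arXiv:1506.07977v2 p. 36 = EJP p. 33)]
[cite: FitznerVanDerHofstad2016NoBLE, §5.3.2 (5.40)–(5.41) PTRF p. 1098] -/
theorem perc_T_eqOne_ge_ge_toReal_le_sum_filter (m₂ m₃ M : ℕ) (hM : 1 + m₃ ≤ M) (x v y : Site d) :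
    ((Letters.perc d p).T (eq 1) (ge m₂) (ge m₃) v y x).toReal ≤
      (∑ LW ∈ (idxExplicitB (1 + m₂) m₃ M x y).filter (fun LW => wordPos LW.2.1 1 = v), (p : ℝ) ^ LW.1) +
        (∑ ur ∈ (idxOneTailB (d := d) (1 + m₂) m₃ M y).filter (fun ur => wordPos ur.1 1 = v),
            (p : ℝ) ^ M * tau d p (wordPos ur.1 M) x) +
          ∑ uu ∈ (idxTwoTail (d := d) m₃ M).filter (fun uu => wordPos uu.1 1 = v),
            (p : ℝ) ^ (M - m₃) * (p : ℝ) ^ m₃ *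
              (tau d p (wordPos uu.1 (M - m₃)) y * tau d p (y + wordPos uu.2 m₃) x) := by
  classical
  have hp0 : 0 ≤ (p : ℝ) := p.2.1
  set B := (∑ LW ∈ (idxExplicitB (1 + m₂) m₃ M x y).filter (fun LW => wordPos LW.2.1 1 = v), (p : ℝ) ^ LW.1) +
        (∑ ur ∈ (idxOneTailB (d := d) (1 + m₂) m₃ M y).filter (fun ur => wordPos ur.1 1 = v),
            (p : ℝ) ^ M * tau d p (wordPos ur.1 M) x) +
          ∑ uu ∈ (idxTwoTail (d := d) m₃ M).filter (fun uu => wordPos uu.1 1 = v),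
            (p : ℝ) ^ (M - m₃) * (p : ℝ) ^ m₃ *
              (tau d p (wordPos uu.1 (M - m₃)) y * tau d p (y + wordPos uu.2 m₃) x) with hB
  have hB0 : 0 ≤ B :=
    add_nonneg (add_nonneg (Finset.sum_nonneg fun _ _ => pow_nonneg hp0 _)
      (Finset.sum_nonneg fun _ _ => mul_nonneg (pow_nonneg hp0 _) (tau_nonneg _ _ _)))
      (Finset.sum_nonneg fun _ _ => mul_nonneg (mul_nonneg (pow_nonneg hp0 _) (pow_nonneg hp0 _))
        (mul_nonneg (tau_nonneg _ _ _) (tau_nonneg _ _ _)))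
  have hle : (Letters.perc d p).T (eq 1) (ge m₂) (ge m₃) v y x ≤ ENNReal.ofReal B := by
    rw [perc_T, repLetter]
    refine Finset.sup_le fun c _ => ?_
    rw [piPerc_genDisjOcc_lineEvents₃_eqOne_ge_ge_eq_ofReal]
    exact ENNReal.ofReal_le_ofReal (piReal_genDisjOcc_lineEvents₃_eqOne₁_le c p m₂ m₃ M hM x v y)
  have := ENNReal.toReal_mono ENNReal.ofReal_ne_top hle
  rwa [ENNReal.toReal_ofReal hB0] at this

/-- **[NoBLE17] (5.40) shape for `Σ_{v∈S₁} 𝓣_{1̲,m₂,m₃}(v,y,x)` at a fixed junction `y`** (line indices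
`(1+m₂, m₃)`; the out-point `v` is the determined first letter, summed fiberwise): the pointwise hypothesis of
`sum_le_extraction_of_pointwise`.
[cite: FitznerVanDerHofstad2016NoBLE, §5.3.2 (5.40) PTRF p. 1098]
[cite: FitznerVanDerHofstad2017, §4.2 (4.17), display after (4.18) (arXiv:1506.07977v2 p. 36 = EJP p. 33)] -/
theorem sum_perc_T_eqOne_ge_ge_toReal_le_extraction (m₂ m₃ M : ℕ) (hM : 1 + m₃ ≤ M) (x y : Site d)
    (S₁ : Finset (Site d)) :
    ∑ v ∈ S₁, ((Letters.perc d p).T (eq 1) (ge m₂) (ge m₃) v y x).toReal ≤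
      (∑ LW ∈ idxExplicitB (1 + m₂) m₃ M x y, (p : ℝ) ^ LW.1) +
        (∑ ur ∈ idxOneTailB (d := d) (1 + m₂) m₃ M y, (p : ℝ) ^ M * tau d p (wordPos ur.1 M) x) +
          ∑ uu ∈ idxTwoTail (d := d) m₃ M,
            (p : ℝ) ^ (M - m₃) * (p : ℝ) ^ m₃ *
              (tau d p (wordPos uu.1 (M - m₃)) y * tau d p (y + wordPos uu.2 m₃) x) := by
  classical
  have hp0 : 0 ≤ (p : ℝ) := p.2.1
  refine (Finset.sum_le_sum fun v _ => perc_T_eqOne_ge_ge_toReal_le_sum_filter p m₂ m₃ M hM x v y).trans ?_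
  rw [Finset.sum_add_distrib, Finset.sum_add_distrib]
  refine add_le_add (add_le_add ?_ ?_) ?_
  · exact Finset.sum_fiberwise_le_sum_of_sum_fiber_nonneg fun v _ =>
      Finset.sum_nonneg fun _ _ => pow_nonneg hp0 _
  · exact Finset.sum_fiberwise_le_sum_of_sum_fiber_nonneg fun v _ =>
      Finset.sum_nonneg fun _ _ => mul_nonneg (pow_nonneg hp0 _) (tau_nonneg _ _ _)
  · exact Finset.sum_fiberwise_le_sum_of_sum_fiber_nonneg fun v _ =>
      Finset.sum_nonneg fun _ _ => mul_nonneg (mul_nonneg (pow_nonneg hp0 _) (pow_nonneg hp0 _))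
        (mul_nonneg (tau_nonneg _ _ _) (tau_nonneg _ _ _))

/-- **EXL-XSLOT, first exact leg, at remainder slots, all finite `S₁, S₂`** (`d ≥ 2`, `p < p_c`, `1 + m₃ ≤ M`,
`x ∈ X`; `R₁` valid for `[M]`, `R₂` for `[M−m₃, m₃]` on `X`):
`Σ_{v∈S₁} Σ_{y∈S₂} 𝓣_{1̲,m₂,m₃}(v,y,x) ≤ Σ_{L=1+m₂+m₃}^{M−1} (L+1−(1+m₂)−m₃) a_L(x) p^L + (M−(1+m₂)−m₃) p^M Γ̄₂ R₁ + p^M Γ̄₂² R₂`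
— the repulsive BUBBLE bound (5.40) at `(1+m₂, m₃)`: the exact bond costs one unit of length and no multiplicity, the
out-point no sum.
[cite: FitznerVanDerHofstad2016NoBLE, §5.3.2 (5.40) p. 1098, first display p. 1097]
[cite: FitznerVanDerHofstad2017, §4.2 (4.17), (4.18) and the display after it (arXiv:1506.07977v2 p. 36)] -/
theorem sum_sum_perc_T_eqOne_ge_ge_toReal_le_slots (hd : 2 ≤ d) (hp : p < criticalProbI d) {m₂ m₃ M : ℕ}
    (hM : 1 + m₃ ≤ M) {x : Site d} {X : Set (Site d)} (hx : x ∈ X) {R₁ R₂ : ℝ}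
    (hR₁ : IsRemKernelConst d [M] X R₁) (hR₂ : IsRemKernelConst d [M - m₃, m₃] X R₂)
    (S₁ S₂ : Finset (Site d)) :
    ∑ v ∈ S₁, ∑ y ∈ S₂, ((Letters.perc d p).T (eq 1) (ge m₂) (ge m₃) v y x).toReal ≤
      (∑ L ∈ Finset.Ico ((1 + m₂) + m₃) M,
          ((L + 1 - (1 + m₂) - m₃ : ℕ) : ℝ) * ((trailWordsTo d L x).card : ℝ) * (p : ℝ) ^ L) +
        ((M - (1 + m₂) - m₃ : ℕ) : ℝ) * ((p : ℝ) ^ M * (nobleSup2 d p * R₁)) +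
          (p : ℝ) ^ M * (nobleSup2 d p ^ 2 * R₂) := by
  rw [Finset.sum_comm]
  exact sum_le_repBubble_slots
    (D := fun y => ∑ v ∈ S₁, ((Letters.perc d p).T (eq 1) (ge m₂) (ge m₃) v y x).toReal)
    (fun S => sum_le_extraction_of_pointwise p (1 + m₂) m₃ M x S
      fun y _ => sum_perc_T_eqOne_ge_ge_toReal_le_extraction p m₂ m₃ M hM x y S₁)
    hd hp (le_trans (Nat.le_add_left m₃ 1) hM) hx hR₁ hR₂ S₂

/-- **EXL-XSLOT (first exact leg), `∑'`/`ofReal` shape in the `bubbleSlotR` currency, ALL out-points**: for `x ∈ X`,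
`Σ'_v Σ'_y 𝓣_{1̲,m₂,m₃}(v,y,x) ≤ ofReal (bubbleSlotR p Γ̄₂ (1+m₂) m₃ M N R₁ R₂)` whenever `N` majorises the trail-word
counts to `x` and `R₁, R₂` are remainder-kernel constants on `X` (`d ≥ 2`, `p < p_c`, `1 + m₃ ≤ M`): every finite
double partial sum is below the right-hand side; the `∑'∑'` is their supremum.
[cite: FitznerVanDerHofstad2016NoBLE, §5.3.2 (5.40) (PTRF 169 (2017) p. 1098)]
[cite: FitznerVanDerHofstad2017, §4.2 (4.17), (4.18) and the display after it (arXiv:1506.07977v2 p. 36)] -/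
theorem tsum_tsum_perc_T_eqOne_ge_ge_le_ofReal (hd : 2 ≤ d) (hp : p < criticalProbI d) {m₂ m₃ M : ℕ}
    (hM : 1 + m₃ ≤ M) {x : Site d} {X : Set (Site d)} (hx : x ∈ X) {N : ℕ → ℕ}
    (hN : ∀ L, (trailWordsTo d L x).card ≤ N L) {R₁ R₂ : ℝ} (hR₁ : IsRemKernelConst d [M] X R₁)
    (hR₂ : IsRemKernelConst d [M - m₃, m₃] X R₂) :
    ∑' v, ∑' y, (Letters.perc d p).T (eq 1) (ge m₂) (ge m₃) v y x ≤
      ENNReal.ofReal (bubbleSlotR p (nobleSup2 d p) (1 + m₂) m₃ M N R₁ R₂) := by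
  classical
  rw [← ENNReal.tsum_prod, ENNReal.tsum_eq_iSup_sum]
  refine iSup_le fun Q => ?_
  set f : Site d → Site d → ℝ≥0∞ := fun v y => (Letters.perc d p).T (eq 1) (ge m₂) (ge m₃) v y x with hf
  have hT : ∀ v y, f v y = ENNReal.ofReal ((f v y).toReal) := fun v y =>
    (ENNReal.ofReal_toReal ((perc_T_le_one p _ _ _ _ _ _).trans_lt ENNReal.one_lt_top).ne).symm
  calc ∑ q ∈ Q, f q.1 q.2
      ≤ ∑ q ∈ Q.image Prod.fst ×ˢ Q.image Prod.snd, f q.1 q.2 :=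
        Finset.sum_le_sum_of_subset Finset.subset_product
    _ = ∑ v ∈ Q.image Prod.fst, ∑ y ∈ Q.image Prod.snd, f v y := Finset.sum_product _ _ _
    _ = ∑ v ∈ Q.image Prod.fst, ∑ y ∈ Q.image Prod.snd, ENNReal.ofReal ((f v y).toReal) :=
        Finset.sum_congr rfl fun v _ => Finset.sum_congr rfl fun y _ => hT v y
    _ = ENNReal.ofReal (∑ v ∈ Q.image Prod.fst, ∑ y ∈ Q.image Prod.snd, (f v y).toReal) := by
        rw [ENNReal.ofReal_sum_of_nonneg fun v _ => Finset.sum_nonneg fun y _ => ENNReal.toReal_nonneg]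
        exact Finset.sum_congr rfl fun v _ =>
          (ENNReal.ofReal_sum_of_nonneg fun y _ => ENNReal.toReal_nonneg).symm
    _ ≤ ENNReal.ofReal (bubbleSlotR p (nobleSup2 d p) (1 + m₂) m₃ M N R₁ R₂) :=
        ENNReal.ofReal_le_ofReal
          ((sum_sum_perc_T_eqOne_ge_ge_toReal_le_slots p hd hp hM hx hR₁ hR₂ _ _).trans
            (bubbleSlotR_mono_count p.2.1 (1 + m₂) m₃ M hN R₁ R₂))

/-- **EXL-XSLOT (first exact leg), the blocks' form `Σ'_y Σ_κ 𝓣_{1̲,m₂,m₃}(e_κ,y,x)`**: the `2d` unit out-points are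
distinct sites (`stepVec` is injective), so the `κ`-sum is a partial sum of the sum over all out-points.
[cite: FitznerVanDerHofstad2017, App. B Table B.4 rows (0,0), (1,0) (arXiv:1506.07977v2 pp. 74–75); §4.2 (4.17) (p. 36)]
[cite: FitznerVanDerHofstad2016NoBLE, §5.3.2 (5.40) (PTRF 169 (2017) p. 1098)] -/
theorem tsum_sum_perc_T_eqOne_ge_ge_stepVec_le_ofReal (hd : 2 ≤ d) (hp : p < criticalProbI d) {m₂ m₃ M : ℕ}
    (hM : 1 + m₃ ≤ M) {x : Site d} {X : Set (Site d)} (hx : x ∈ X) {N : ℕ → ℕ}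
    (hN : ∀ L, (trailWordsTo d L x).card ≤ N L) {R₁ R₂ : ℝ} (hR₁ : IsRemKernelConst d [M] X R₁)
    (hR₂ : IsRemKernelConst d [M - m₃, m₃] X R₂) :
    ∑' y, ∑ κ : Fin d × Bool, (Letters.perc d p).T (eq 1) (ge m₂) (ge m₃) (stepVec κ) y x ≤
      ENNReal.ofReal (bubbleSlotR p (nobleSup2 d p) (1 + m₂) m₃ M N R₁ R₂) := by
  calc ∑' y, ∑ κ : Fin d × Bool, (Letters.perc d p).T (eq 1) (ge m₂) (ge m₃) (stepVec κ) y x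
      ≤ ∑' y, ∑' v, (Letters.perc d p).T (eq 1) (ge m₂) (ge m₃) v y x := by
        refine ENNReal.tsum_le_tsum fun y => ?_
        calc ∑ κ : Fin d × Bool, (Letters.perc d p).T (eq 1) (ge m₂) (ge m₃) (stepVec κ) y x
            = ∑' κ : Fin d × Bool, (Letters.perc d p).T (eq 1) (ge m₂) (ge m₃) (stepVec κ) y x :=
              (tsum_fintype _).symm
          _ ≤ ∑' v, (Letters.perc d p).T (eq 1) (ge m₂) (ge m₃) v y x :=
              ENNReal.tsum_comp_le_tsum_of_injective stepVec_injective'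
                (fun v => (Letters.perc d p).T (eq 1) (ge m₂) (ge m₃) v y x)
    _ = ∑' v, ∑' y, (Letters.perc d p).T (eq 1) (ge m₂) (ge m₃) v y x := ENNReal.tsum_comm
    _ ≤ _ := tsum_tsum_perc_T_eqOne_ge_ge_le_ofReal p hd hp hM hx hN hR₁ hR₂

end Letter

/-! ## E. Both first lines exact: `𝓣_{1̲,1̲,m₃}(v,y,x)`, the junction PINNED at position `2` (multiplicity one) -/

section FirstTwoExact

variable {k : ℕ}

/-- **Coding of a member of `𝓣_{1̲,1̲,m₃}(v,y,x)`.**  Both exact lines are single bonds, so the coded trail `W` has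
`W(1) = v`, `W(2) = y` — the junction sits at position `2` — and `W(L) = x` with `2 + m₃ ≤ L`; the bonds `[0,1)`,
`[1,2)` lie on the levels `c₀`, `c₁`, the arc `[2,L)` is open on `c₂`:
`exists_trail_of_mem_genDisjOcc_lineEvents₃_eqOne₁` applied to the witness sets, the second witness shrunk to the
bond `(v,y)`, after which `#arc[1,r) = r − 1 ≤ 1` pins `r = 2`.
[cite: FitznerVanDerHofstad2017, §4.2 Def. 4.1, (4.17) (arXiv:1506.07977v2 pp. 35–36 = EJP p. 33)]
[cite: FitznerVanDerHofstad2016NoBLE, §5.3.1 (5.35) PTRF p. 1097] -/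
theorem exists_trail_of_mem_genDisjOcc_lineEvents₃_eqOne₁_eqOne₂ {c : Fin 3 → Fin k}
    {ω : Fin k → BondConfig (Site d)} (hω : ∀ j, ω j ⊆ (zdGraph d).edgeSet) {m₃ : ℕ} {v y x : Site d}
    (h : ω ∈ genDisjOcc (lineEvents₃ (eq 1) (eq 1) (ge m₃) v y x) c) :
    ∃ (L : ℕ) (W : Fin L → Fin d × Bool), IsTrail W ∧ 2 + m₃ ≤ L ∧
      wordPos W 1 = v ∧ wordPos W 2 = y ∧ wordPos W L = x ∧
      (↑(wordArc W 0 1) : Set (Sym2 (Site d))) ⊆ ω (c 0) ∧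
        (↑(wordArc W 1 2) : Set (Sym2 (Site d))) ⊆ ω (c 1) ∧
          (↑(wordArc W 2 L) : Set (Sym2 (Site d))) ⊆ ω (c 2) := by
  classical
  obtain ⟨K, hKω, hKA, hdisj⟩ := h
  have hA0 : K 0 ∈ (openConnEq 1 (0 : Site d) v : Set (BondConfig (Site d))) := by
    simpa [lineEvents₃] using hKA 0
  have hA1 : K 1 ∈ (openConnEq 1 v y : Set (BondConfig (Site d))) := by simpa [lineEvents₃] using hKA 1
  have hA2 : K 2 ∈ (openConnGe m₃ y x : Set (BondConfig (Site d))) := by simpa [lineEvents₃] using hKA 2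
  obtain ⟨hvy, hb⟩ := (mem_openConnEq_one_iff v y (K 1)).1 hA1
  have hb0 : s(v, y) ∉ K 0 := fun h' => Set.disjoint_left.1 (hdisj (show (1 : Fin 3) ≠ 0 by decide)) hb h'
  have hb2 : s(v, y) ∉ K 2 := fun h' => Set.disjoint_left.1 (hdisj (show (1 : Fin 3) ≠ 2 by decide)) hb h'
  -- the witness sets as a configuration on three levels, the second one shrunk to the bond `(v,y)`
  let ω' : Fin 3 → BondConfig (Site d) := ![K 0, {s(v, y)}, K 2]
  have hω'0 : ω' 0 = K 0 := rfl
  have hω'1 : ω' 1 = {s(v, y)} := rfl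
  have hω'2 : ω' 2 = K 2 := rfl
  have hω'lat : ∀ j, ω' j ⊆ (zdGraph d).edgeSet := by
    intro j
    fin_cases j
    · exact (hKω 0).trans (hω _)
    · show ({s(v, y)} : Set (Sym2 (Site d))) ⊆ _
      exact Set.singleton_subset_iff.2 (hω _ (hKω 1 hb))
    · exact (hKω 2).trans (hω _)
  have hmem : ω' ∈ genDisjOcc (lineEvents₃ (eq 1) (ge 1) (ge m₃) v y x) (fun i : Fin 3 => i) := by
    refine ⟨ω', fun i => subset_rfl, fun i => ?_, ?_⟩
    · fin_cases i
      · simpa [lineEvents₃, hω'0] using hA0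
      · simpa [lineEvents₃, hω'1] using
          openConnEq_subset_openConnGe 1 v y
            ((mem_openConnEq_one_iff v y ({s(v, y)} : Set (Sym2 (Site d)))).2 ⟨hvy, Set.mem_singleton _⟩)
      · simpa [lineEvents₃, hω'2] using hA2
    · intro i j hij
      fin_cases i <;> fin_cases j
      · exact absurd rfl hij
      · simpa [hω'0, hω'1] using hb0
      · simpa [hω'0, hω'2] using hdisj (show (0 : Fin 3) ≠ 2 by decide)
      · simpa [hω'0, hω'1] using hb0
      · exact absurd rfl hij
      · simpa [hω'1, hω'2] using hb2
      · simpa [hω'0, hω'2] using hdisj (show (2 : Fin 3) ≠ 0 by decide)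
      · simpa [hω'1, hω'2] using hb2
      · exact absurd rfl hij
  obtain ⟨L, r, W, hW, hr, hrL, hv, hy, hx, h0, h1, h2⟩ :=
    exists_trail_of_mem_genDisjOcc_lineEvents₃_eqOne₁ hω'lat hmem
  -- the second arc is the single bond `(v,y)`: a trail has `r − 1` distinct edges there
  have hcard : (wordArc W 1 r).card ≤ 1 := by
    have hsub : wordArc W 1 r ⊆ {s(v, y)} := by
      intro e he
      have := h1 (Finset.mem_coe.2 he)
      simpa [hω'1] using this
    simpa using Finset.card_le_card hsub
  rw [hW.card_wordArc (by omega)] at hcard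
  have hr' : r = 2 := by omega
  subst hr'
  refine ⟨L, W, hW, hrL, hv, hy, hx, ?_, ?_, ?_⟩
  · exact h0.trans (by rw [hω'0]; exact hKω 0)
  · refine h1.trans ?_
    rw [hω'1]
    exact Set.singleton_subset_iff.2 (hKω 1 hb)
  · exact h2.trans (by rw [hω'2]; exact hKω 2)

/-- **(4.17) with both first lines exact, member `c`, pointwise in `(v,y)`**: the (5.40)-type values at line indices
`(2, m₃)` with the junction PINNED at position `2` — no multiplicity — and the out-point the first letter: EXPLICIT
`W ∈ 𝓦_L(x)`, `L ∈ [2+m₃, M)`, with `W(1) = v`, `W(2) = y` (value `p^L`); ONE TAIL `u ∈ 𝓦_M` with `u(1) = v`,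
`u(2) = y` (value `p^M τ_p(u(M), x)`; used when `2 < M − m₃`); TWO TAILS as in
`piReal_genDisjOcc_lineEvents₃_eqOne₁_le` (`M − m₃ ≤ 2`).  `2 + m₃ ≤ M` keeps the pinned junction inside `u`.
[cite: FitznerVanDerHofstad2016NoBLE, §5.3.2 (5.40)–(5.41) PTRF p. 1098]
[cite: FitznerVanDerHofstad2017, §4.2 (4.17) and the display after (4.18) (arXiv:1506.07977v2 p. 36 = EJP p. 33)] -/
theorem piReal_genDisjOcc_lineEvents₃_eqOne₁_eqOne₂_le (c : Fin 3 → Fin k) (p : unitInterval) (m₃ M : ℕ)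
    (hM : 2 + m₃ ≤ M) (x v y : Site d) :
    (Measure.pi (fun _ : Fin k => bondPercolation (zdGraph d) p)).real
        (genDisjOcc (lineEvents₃ (eq 1) (eq 1) (ge m₃) v y x) c) ≤
      (∑ LW ∈ ((Finset.Ico (2 + m₃) M).sigma fun L => trailWordsTo d L x).filter
            (fun LW => wordPos LW.2 1 = v ∧ wordPos LW.2 2 = y), (p : ℝ) ^ LW.1) +
        (∑ u ∈ (trailWords d M).filter (fun u => wordPos u 1 = v ∧ wordPos u 2 = y),
            (p : ℝ) ^ M * tau d p (wordPos u M) x) +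
          ∑ uu ∈ (idxTwoTail (d := d) m₃ M).filter (fun uu => wordPos uu.1 1 = v),
            (p : ℝ) ^ (M - m₃) * (p : ℝ) ^ m₃ *
              (tau d p (wordPos uu.1 (M - m₃)) y * tau d p (y + wordPos uu.2 m₃) x) := by
  classical
  set μ := bondPercolation (zdGraph d) p with hμ
  set ν : Measure (Fin k → BondConfig (Site d)) := Measure.pi (fun _ : Fin k => μ) with hν
  set T : Set (Fin k → BondConfig (Site d)) := genDisjOcc (lineEvents₃ (eq 1) (eq 1) (ge m₃) v y x) c with hT
  set IE := ((Finset.Ico (2 + m₃) M).sigma fun L => trailWordsTo d L x).filter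
      (fun LW => wordPos LW.2 1 = v ∧ wordPos LW.2 2 = y) with hIE
  set IO := (trailWords d M).filter (fun u => wordPos u 1 = v ∧ wordPos u 2 = y) with hIO
  set IT := (idxTwoTail (d := d) m₃ M).filter (fun uu => wordPos uu.1 1 = v) with hIT
  set UE : Set (Fin k → BondConfig (Site d)) := ⋃ LW ∈ IE, boxOf (piecesE LW.2 1 2) labE c with hUE
  set UO : Set (Fin k → BondConfig (Site d)) := ⋃ u ∈ IO, boxOf (piecesO u 1 2 x) labO c with hUO
  set UT : Set (Fin k → BondConfig (Site d)) := ⋃ uu ∈ IT, boxOf (piecesT2 uu.1 1 uu.2 x y) labT2 c with hUT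
  set bad : Set (Fin k → BondConfig (Site d)) :=
    ⋃ j : Fin k, Function.eval j ⁻¹' {ω | ¬ ω ⊆ (zdGraph d).edgeSet} with hbad
  have h0 : μ {ω | ¬ ω ⊆ (zdGraph d).edgeSet} = 0 := by
    have := ProbabilityTheory.setBernoulli_ae_subset (u := (zdGraph d).edgeSet) (p := p)
    rw [Filter.Eventually, mem_ae_iff, Set.compl_setOf] at this
    exact this
  have hbad0 : ν.real bad = 0 := by
    rw [measureReal_def, measure_iUnion_null fun j => ?_, ENNReal.toReal_zero]
    exact Measure.pi_eval_preimage_null (fun _ : Fin k => μ) h0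
  -- the covering: explicit (`L < M`), one tail (`2 < M − m₃`), two tails (`M − m₃ ≤ 2`)
  have hcov : T ⊆ bad ∪ (UE ∪ UO ∪ UT) := by
    intro ω hω
    by_cases hb : ∀ j, ω j ⊆ (zdGraph d).edgeSet
    · right
      obtain ⟨L, W, hW, hL, hv, hy, hx, hW0, hW1, hW2⟩ :=
        exists_trail_of_mem_genDisjOcc_lineEvents₃_eqOne₁_eqOne₂ hb hω
      by_cases hLM : L < M
      · refine Or.inl (Or.inl (Set.mem_iUnion₂.2 ⟨⟨L, W⟩, ?_, ?_⟩))
        · rw [hIE, Finset.mem_filter, Finset.mem_sigma, Finset.mem_Ico, mem_trailWordsTo]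
          exact ⟨⟨⟨hL, hLM⟩, hW, hx⟩, hv, hy⟩
        · exact mem_boxE_of_trail c hW (show 1 ≤ 2 by omega) (show 2 ≤ L by omega) hW0 hW1 hW2
      · replace hLM : M ≤ L := not_lt.1 hLM
        by_cases h2M : 2 < M - m₃
        · refine Or.inl (Or.inr (Set.mem_iUnion₂.2 ⟨wordTake W M hLM, ?_,
            mem_boxO_of_trail c hW hLM (by omega) (by omega) hx hW0 hW1 hW2⟩))
          rw [hIO, Finset.mem_filter, mem_trailWords, wordPos_wordTake W hLM (show 1 ≤ M by omega),
            wordPos_wordTake W hLM (show 2 ≤ M by omega)]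
          exact ⟨hW.wordTake hLM, hv, hy⟩
        · replace h2M : M - m₃ ≤ 2 := not_lt.1 h2M
          have hML : M - m₃ ≤ L := by omega
          refine Or.inr (Set.mem_iUnion₂.2 ⟨(wordTake W (M - m₃) hML, wordSeg W 2 m₃ hL), ?_,
            mem_boxT2_of_trail c hW (by omega) h2M hL hML hy hx hW0 hW1 hW2⟩)
          rw [hIT, Finset.mem_filter, idxTwoTail, Finset.mem_product, mem_trailWords, mem_trailWords]
          refine ⟨⟨hW.wordTake hML, hW.wordSeg hL⟩, ?_⟩
          show wordPos (wordTake W (M - m₃) hML) 1 = v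
          rw [wordPos_wordTake W hML (by omega), hv]
    · left
      obtain ⟨j, hj⟩ := not_forall.1 hb
      exact Set.mem_iUnion.2 ⟨j, hj⟩
  -- the measure of each box
  have hE : ν.real UE ≤ ∑ LW ∈ IE, (p : ℝ) ^ LW.1 := by
    refine (measureReal_biUnion_finset_le _ _).trans (Finset.sum_le_sum fun LW hLW => ?_)
    have hi := (Finset.mem_filter.1 hLW).1
    rw [Finset.mem_sigma, Finset.mem_Ico, mem_trailWordsTo] at hi
    exact piReal_boxE_le c p hi.2.1 (by omega) (by omega)
  have hO : ν.real UO ≤ ∑ u ∈ IO, (p : ℝ) ^ M * tau d p (wordPos u M) x := by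
    refine (measureReal_biUnion_finset_le _ _).trans (Finset.sum_le_sum fun u hu => ?_)
    have hi := (Finset.mem_filter.1 hu).1
    rw [mem_trailWords] at hi
    exact piReal_boxO_le c p hi (by omega) (by omega) x
  have hT2 : ν.real UT ≤ ∑ uu ∈ IT, (p : ℝ) ^ (M - m₃) * (p : ℝ) ^ m₃ *
      (tau d p (wordPos uu.1 (M - m₃)) y * tau d p (y + wordPos uu.2 m₃) x) := by
    refine (measureReal_biUnion_finset_le _ _).trans (Finset.sum_le_sum fun uu huu => ?_)
    have hi := (Finset.mem_filter.1 huu).1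
    simp only [idxTwoTail, Finset.mem_product, mem_trailWords] at hi
    exact piReal_boxT2_le c p hi.1 hi.2 (by omega) x y
  calc ν.real T ≤ ν.real (bad ∪ (UE ∪ UO ∪ UT)) := measureReal_mono hcov
    _ ≤ ν.real bad + ν.real (UE ∪ UO ∪ UT) := measureReal_union_le _ _
    _ ≤ 0 + (ν.real UE + ν.real UO + ν.real UT) := by
        refine add_le_add hbad0.le ((measureReal_union_le _ _).trans ?_)
        exact add_le_add (measureReal_union_le _ _) le_rfl
    _ ≤ _ := by rw [zero_add]; exact add_le_add (add_le_add hE hO) hT2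

/-- `ℙ_p^{⊗3}` of the instance's letter `𝓣_{1̲,1̲,m₃}` is the product Bernoulli measure of
`piReal_genDisjOcc_lineEvents₃_eqOne₁_eqOne₂_le`, in `ℝ≥0∞`.
[cite: FitznerVanDerHofstad2017, §4.2 (4.17) (arXiv:1506.07977v2 p. 36)] -/
theorem piPerc_genDisjOcc_lineEvents₃_eqOne_eqOne_ge_eq_ofReal (p : unitInterval) (c : Fin 3 → Fin 3) (m₃ : ℕ)
    (v y x : Site d) :
    piPerc d p 3 (genDisjOcc (lineEvents₃ (eq 1) (eq 1) (ge m₃) v y x) c) =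
      ENNReal.ofReal ((Measure.pi (fun _ : Fin 3 => bondPercolation (zdGraph d) p)).real
        (genDisjOcc (lineEvents₃ (eq 1) (eq 1) (ge m₃) v y x) c)) := by
  rw [piPerc, ofReal_measureReal (measure_ne_top _ _)]

variable (p : unitInterval)

/-- **`𝓣_{1̲,1̲,m₃}(v,y,x)` pointwise by extraction** (every member of the maximum obeys
`piReal_genDisjOcc_lineEvents₃_eqOne₁_eqOne₂_le`, whose right-hand side does not depend on the assignment).
[cite: FitznerVanDerHofstad2017, §4.2 (4.17) (arXiv:1506.07977v2 p. 36 = EJP p. 33)]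
[cite: FitznerVanDerHofstad2016NoBLE, §5.3.2 (5.40)–(5.41) PTRF p. 1098] -/
theorem perc_T_eqOne_eqOne_ge_toReal_le_sum_filter (m₃ M : ℕ) (hM : 2 + m₃ ≤ M) (x v y : Site d) :
    ((Letters.perc d p).T (eq 1) (eq 1) (ge m₃) v y x).toReal ≤
      (∑ LW ∈ ((Finset.Ico (2 + m₃) M).sigma fun L => trailWordsTo d L x).filter
            (fun LW => wordPos LW.2 1 = v ∧ wordPos LW.2 2 = y), (p : ℝ) ^ LW.1) +
        (∑ u ∈ (trailWords d M).filter (fun u => wordPos u 1 = v ∧ wordPos u 2 = y),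
            (p : ℝ) ^ M * tau d p (wordPos u M) x) +
          ∑ uu ∈ (idxTwoTail (d := d) m₃ M).filter (fun uu => wordPos uu.1 1 = v),
            (p : ℝ) ^ (M - m₃) * (p : ℝ) ^ m₃ *
              (tau d p (wordPos uu.1 (M - m₃)) y * tau d p (y + wordPos uu.2 m₃) x) := by
  classical
  have hp0 : 0 ≤ (p : ℝ) := p.2.1
  set B := (∑ LW ∈ ((Finset.Ico (2 + m₃) M).sigma fun L => trailWordsTo d L x).filter
            (fun LW => wordPos LW.2 1 = v ∧ wordPos LW.2 2 = y), (p : ℝ) ^ LW.1) +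
        (∑ u ∈ (trailWords d M).filter (fun u => wordPos u 1 = v ∧ wordPos u 2 = y),
            (p : ℝ) ^ M * tau d p (wordPos u M) x) +
          ∑ uu ∈ (idxTwoTail (d := d) m₃ M).filter (fun uu => wordPos uu.1 1 = v),
            (p : ℝ) ^ (M - m₃) * (p : ℝ) ^ m₃ *
              (tau d p (wordPos uu.1 (M - m₃)) y * tau d p (y + wordPos uu.2 m₃) x) with hB
  have hB0 : 0 ≤ B :=
    add_nonneg (add_nonneg (Finset.sum_nonneg fun _ _ => pow_nonneg hp0 _)
      (Finset.sum_nonneg fun _ _ => mul_nonneg (pow_nonneg hp0 _) (tau_nonneg _ _ _)))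
      (Finset.sum_nonneg fun _ _ => mul_nonneg (mul_nonneg (pow_nonneg hp0 _) (pow_nonneg hp0 _))
        (mul_nonneg (tau_nonneg _ _ _) (tau_nonneg _ _ _)))
  have hle : (Letters.perc d p).T (eq 1) (eq 1) (ge m₃) v y x ≤ ENNReal.ofReal B := by
    rw [perc_T, repLetter]
    refine Finset.sup_le fun c _ => ?_
    rw [piPerc_genDisjOcc_lineEvents₃_eqOne_eqOne_ge_eq_ofReal]
    exact ENNReal.ofReal_le_ofReal (piReal_genDisjOcc_lineEvents₃_eqOne₁_eqOne₂_le c p m₃ M hM x v y)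
  have := ENNReal.toReal_mono ENNReal.ofReal_ne_top hle
  rwa [ENNReal.toReal_ofReal hB0] at this

/-- **EXL-XSLOT, both first lines exact, at remainder slots, all finite `S₁, S₂`** (`d ≥ 2`, `p < p_c`,
`2 + m₃ ≤ M`, `x ∈ X`; `R₁` valid for `[M]`, `R₂` for `[M−m₃, m₃]` on `X`):
`Σ_{v∈S₁} Σ_{y∈S₂} 𝓣_{1̲,1̲,m₃}(v,y,x) ≤ Σ_{L=2+m₃}^{M−1} a_L(x) p^L + p^M Γ̄₂ R₁ + p^M Γ̄₂² R₂` — MULTIPLICITY ONE: the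
two exact bonds pin the junction at position `2`, so the (5.40) sum over the junction position collapses; the
explicit and one-tail families are summed over the two filter keys `(W(1), W(2))` (`sum_sum_sum_filter_le`), the
two-tail family fibrewise over `W(1)` and then through the two-tail slot.
[cite: FitznerVanDerHofstad2016NoBLE, §5.3.2 (5.40) p. 1098, first display p. 1097]
[cite: FitznerVanDerHofstad2017, §4.2 (4.17), (4.18) and the display after it (arXiv:1506.07977v2 p. 36)] -/
theorem sum_sum_perc_T_eqOne_eqOne_ge_toReal_le_slots (hd : 2 ≤ d) (hp : p < criticalProbI d) {m₃ M : ℕ}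
    (hM : 2 + m₃ ≤ M) {x : Site d} {X : Set (Site d)} (hx : x ∈ X) {R₁ R₂ : ℝ}
    (hR₁ : IsRemKernelConst d [M] X R₁) (hR₂ : IsRemKernelConst d [M - m₃, m₃] X R₂)
    (S₁ S₂ : Finset (Site d)) :
    ∑ v ∈ S₁, ∑ y ∈ S₂, ((Letters.perc d p).T (eq 1) (eq 1) (ge m₃) v y x).toReal ≤
      (∑ L ∈ Finset.Ico (2 + m₃) M, ((trailWordsTo d L x).card : ℝ) * (p : ℝ) ^ L) +
        (p : ℝ) ^ M * (nobleSup2 d p * R₁) + (p : ℝ) ^ M * (nobleSup2 d p ^ 2 * R₂) := by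
  classical
  have hp0 : 0 ≤ (p : ℝ) := p.2.1
  refine (Finset.sum_le_sum fun v _ => Finset.sum_le_sum fun y _ =>
    perc_T_eqOne_eqOne_ge_toReal_le_sum_filter p m₃ M hM x v y).trans ?_
  simp only [Finset.sum_add_distrib]
  refine add_le_add (add_le_add ?_ ?_) ?_
  · -- explicit family: joint fibres of `(W(1), W(2))`, then `Σ_{⟨L,W⟩} p^L = Σ_L a_L(x) p^L`
    refine (sum_sum_sum_filter_le S₁ S₂ _ _ _ fun _ _ => pow_nonneg hp0 _).trans (le_of_eq ?_)
    rw [Finset.sum_sigma]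
    exact Finset.sum_congr rfl fun L _ => by simp only [Finset.sum_const, nsmul_eq_mul]
  · -- one-tail family: joint fibres of `(u(1), u(2))`, then the one-tail slot
    refine (sum_sum_sum_filter_le S₁ S₂ _ _ _ fun u _ =>
      mul_nonneg (pow_nonneg hp0 _) (tau_nonneg _ _ _)).trans ?_
    rw [← Finset.mul_sum]
    refine mul_le_mul_of_nonneg_left ?_ (pow_nonneg hp0 M)
    calc ∑ u ∈ trailWords d M, tau d p (wordPos u M) x
        = ∑ u ∈ trailWords d M, tau d p 0 (x - wordPos u M) :=
          Finset.sum_congr rfl fun u _ => tau_eq_tau_zero_sub p (wordPos u M) x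
      _ ≤ nobleSup2 d p * R₁ := sum_trailWords_tau_le_slot hR₁ p hp hx
  · -- two-tail family: fibres of `u₁(1)` after exchanging the `y`-sum, then the two-tail slot
    calc ∑ v ∈ S₁, ∑ y ∈ S₂, ∑ uu ∈ (idxTwoTail (d := d) m₃ M).filter (fun uu => wordPos uu.1 1 = v),
          (p : ℝ) ^ (M - m₃) * (p : ℝ) ^ m₃ *
            (tau d p (wordPos uu.1 (M - m₃)) y * tau d p (y + wordPos uu.2 m₃) x)
        = ∑ v ∈ S₁, ∑ uu ∈ (idxTwoTail (d := d) m₃ M).filter (fun uu => wordPos uu.1 1 = v), ∑ y ∈ S₂,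
            (p : ℝ) ^ (M - m₃) * (p : ℝ) ^ m₃ *
              (tau d p (wordPos uu.1 (M - m₃)) y * tau d p (y + wordPos uu.2 m₃) x) :=
          Finset.sum_congr rfl fun v _ => Finset.sum_comm
      _ ≤ ∑ uu ∈ idxTwoTail (d := d) m₃ M, ∑ y ∈ S₂,
            (p : ℝ) ^ (M - m₃) * (p : ℝ) ^ m₃ *
              (tau d p (wordPos uu.1 (M - m₃)) y * tau d p (y + wordPos uu.2 m₃) x) :=
          Finset.sum_fiberwise_le_sum_of_sum_fiber_nonneg fun v _ =>
            Finset.sum_nonneg fun uu _ => Finset.sum_nonneg fun y _ =>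
              mul_nonneg (mul_nonneg (pow_nonneg hp0 _) (pow_nonneg hp0 _))
                (mul_nonneg (tau_nonneg _ _ _) (tau_nonneg _ _ _))
      _ = (p : ℝ) ^ (M - m₃) * (p : ℝ) ^ m₃ *
            ∑ uu ∈ (trailWords d (M - m₃)) ×ˢ (trailWords d m₃),
              ∑ y ∈ S₂, tau d p (wordPos uu.1 (M - m₃)) y * tau d p (y + wordPos uu.2 m₃) x := by
          rw [idxTwoTail, Finset.mul_sum]
          exact Finset.sum_congr rfl fun uu _ => by rw [Finset.mul_sum]
      _ ≤ (p : ℝ) ^ M * (nobleSup2 d p ^ 2 * R₂) := by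
          rw [← pow_add, Nat.sub_add_cancel (show m₃ ≤ M by omega)]
          exact mul_le_mul_of_nonneg_left (sum_prod_trailWords_le_slot hd hR₂ p hp hx S₂) (pow_nonneg hp0 M)

/-- **EXL-XSLOT (both first lines exact), `∑'`/`ofReal` shape, ALL out-points**: for `x ∈ X`,
`Σ'_v Σ'_y 𝓣_{1̲,1̲,m₃}(v,y,x) ≤ ofReal (Σ_{L∈[2+m₃,M)} N L·p^L + p^M Γ̄₂ R₁ + p^M Γ̄₂² R₂)` whenever `N` majorises the
trail-word counts to `x` and `R₁, R₂` are remainder-kernel constants on `X` (`d ≥ 2`, `p < p_c`, `2 + m₃ ≤ M`).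
[cite: FitznerVanDerHofstad2016NoBLE, §5.3.2 (5.40) (PTRF 169 (2017) p. 1098)]
[cite: FitznerVanDerHofstad2017, §4.2 (4.17), (4.18) and the display after it (arXiv:1506.07977v2 p. 36)] -/
theorem tsum_tsum_perc_T_eqOne_eqOne_ge_le_ofReal (hd : 2 ≤ d) (hp : p < criticalProbI d) {m₃ M : ℕ}
    (hM : 2 + m₃ ≤ M) {x : Site d} {X : Set (Site d)} (hx : x ∈ X) {N : ℕ → ℕ}
    (hN : ∀ L, (trailWordsTo d L x).card ≤ N L) {R₁ R₂ : ℝ} (hR₁ : IsRemKernelConst d [M] X R₁)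
    (hR₂ : IsRemKernelConst d [M - m₃, m₃] X R₂) :
    ∑' v, ∑' y, (Letters.perc d p).T (eq 1) (eq 1) (ge m₃) v y x ≤
      ENNReal.ofReal ((∑ L ∈ Finset.Ico (2 + m₃) M, (N L : ℝ) * (p : ℝ) ^ L) +
        (p : ℝ) ^ M * (nobleSup2 d p * R₁) + (p : ℝ) ^ M * (nobleSup2 d p ^ 2 * R₂)) := by
  classical
  have hp0 : 0 ≤ (p : ℝ) := p.2.1
  have hmono : (∑ L ∈ Finset.Ico (2 + m₃) M, ((trailWordsTo d L x).card : ℝ) * (p : ℝ) ^ L) ≤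
      ∑ L ∈ Finset.Ico (2 + m₃) M, (N L : ℝ) * (p : ℝ) ^ L :=
    Finset.sum_le_sum fun L _ => mul_le_mul_of_nonneg_right (by exact_mod_cast hN L) (pow_nonneg hp0 L)
  rw [← ENNReal.tsum_prod, ENNReal.tsum_eq_iSup_sum]
  refine iSup_le fun Q => ?_
  set f : Site d → Site d → ℝ≥0∞ := fun v y => (Letters.perc d p).T (eq 1) (eq 1) (ge m₃) v y x with hf
  have hT : ∀ v y, f v y = ENNReal.ofReal ((f v y).toReal) := fun v y =>
    (ENNReal.ofReal_toReal ((perc_T_le_one p _ _ _ _ _ _).trans_lt ENNReal.one_lt_top).ne).symm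
  calc ∑ q ∈ Q, f q.1 q.2
      ≤ ∑ q ∈ Q.image Prod.fst ×ˢ Q.image Prod.snd, f q.1 q.2 :=
        Finset.sum_le_sum_of_subset Finset.subset_product
    _ = ∑ v ∈ Q.image Prod.fst, ∑ y ∈ Q.image Prod.snd, f v y := Finset.sum_product _ _ _
    _ = ∑ v ∈ Q.image Prod.fst, ∑ y ∈ Q.image Prod.snd, ENNReal.ofReal ((f v y).toReal) :=
        Finset.sum_congr rfl fun v _ => Finset.sum_congr rfl fun y _ => hT v y
    _ = ENNReal.ofReal (∑ v ∈ Q.image Prod.fst, ∑ y ∈ Q.image Prod.snd, (f v y).toReal) := by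
        rw [ENNReal.ofReal_sum_of_nonneg fun v _ => Finset.sum_nonneg fun y _ => ENNReal.toReal_nonneg]
        exact Finset.sum_congr rfl fun v _ =>
          (ENNReal.ofReal_sum_of_nonneg fun y _ => ENNReal.toReal_nonneg).symm
    _ ≤ _ :=
        ENNReal.ofReal_le_ofReal
          ((sum_sum_perc_T_eqOne_eqOne_ge_toReal_le_slots p hd hp hM hx hR₁ hR₂ _ _).trans
            (add_le_add (add_le_add hmono le_rfl) le_rfl))

/-- **EXL-XSLOT (both first lines exact), the blocks' form `Σ'_y Σ_κ 𝓣_{1̲,1̲,m₃}(e_κ,y,x)`**: the `κ`-sum is a partial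
sum of the sum over all out-points (`stepVec` is injective).
[cite: FitznerVanDerHofstad2017, App. B Table B.4 row (0,0) (arXiv:1506.07977v2 p. 75); §4.2 (4.17) (p. 36)]
[cite: FitznerVanDerHofstad2016NoBLE, §5.3.2 (5.40) (PTRF 169 (2017) p. 1098)] -/
theorem tsum_sum_perc_T_eqOne_eqOne_ge_stepVec_le_ofReal (hd : 2 ≤ d) (hp : p < criticalProbI d) {m₃ M : ℕ}
    (hM : 2 + m₃ ≤ M) {x : Site d} {X : Set (Site d)} (hx : x ∈ X) {N : ℕ → ℕ}
    (hN : ∀ L, (trailWordsTo d L x).card ≤ N L) {R₁ R₂ : ℝ} (hR₁ : IsRemKernelConst d [M] X R₁)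
    (hR₂ : IsRemKernelConst d [M - m₃, m₃] X R₂) :
    ∑' y, ∑ κ : Fin d × Bool, (Letters.perc d p).T (eq 1) (eq 1) (ge m₃) (stepVec κ) y x ≤
      ENNReal.ofReal ((∑ L ∈ Finset.Ico (2 + m₃) M, (N L : ℝ) * (p : ℝ) ^ L) +
        (p : ℝ) ^ M * (nobleSup2 d p * R₁) + (p : ℝ) ^ M * (nobleSup2 d p ^ 2 * R₂)) := by
  calc ∑' y, ∑ κ : Fin d × Bool, (Letters.perc d p).T (eq 1) (eq 1) (ge m₃) (stepVec κ) y x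
      ≤ ∑' y, ∑' v, (Letters.perc d p).T (eq 1) (eq 1) (ge m₃) v y x := by
        refine ENNReal.tsum_le_tsum fun y => ?_
        calc ∑ κ : Fin d × Bool, (Letters.perc d p).T (eq 1) (eq 1) (ge m₃) (stepVec κ) y x
            = ∑' κ : Fin d × Bool, (Letters.perc d p).T (eq 1) (eq 1) (ge m₃) (stepVec κ) y x :=
              (tsum_fintype _).symm
          _ ≤ ∑' v, (Letters.perc d p).T (eq 1) (eq 1) (ge m₃) v y x :=
              ENNReal.tsum_comp_le_tsum_of_injective stepVec_injective'
                (fun v => (Letters.perc d p).T (eq 1) (eq 1) (ge m₃) v y x)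
    _ = ∑' v, ∑' y, (Letters.perc d p).T (eq 1) (eq 1) (ge m₃) v y x := ENNReal.tsum_comm
    _ ≤ _ := tsum_tsum_perc_T_eqOne_eqOne_ge_le_ofReal p hd hp hM hx hN hR₁ hR₂

end FirstTwoExact

/-! ## F. The cells: the four primed `(0,0)` objects (endpoint `0`) and `(A^ι)_{1,0}` (endpoint a unit vector) -/

section Cells

variable (p : unitInterval)

/-- **`Σ'_x Σ_κ (1 − δ_{0,x})(1 − δ_{x,e_κ}) 𝓣_{1̲,1,1}(e_κ,x,0) ≤ ofReal (bubbleSlotR p Γ̄₂ 2 1 M N₀ R₁ R₂)`** — the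
letter sum of `(Ā^{ι}')_{0,0}` (and of `(A^{ι}')_{0,0}`) by EXL-XSLOT at the endpoint `0` (`N₀` majorises the closed
trail-word counts, `R₁` valid for `[M]`, `R₂` for `[M−1, 1]` on a set containing `0`; `2 ≤ M`): drop both indicator
weights.
[cite: FitznerVanDerHofstad2017, §6.1 case a = b = 0 (arXiv:1506.07977v2 p. 59); App. B Table B.4 row (0,0) (p. 75)]
[cite: FitznerVanDerHofstad2016NoBLE, §5.3.2 (5.40) (PTRF 169 (2017) p. 1098); notebook Percolation.nb cell 10 (Bubble₃)] -/
theorem perc_tsum_sum_kdc_kdc_T_eqOne_one_one_stepVec_le_xslot (hd : 2 ≤ d) (hp : p < criticalProbI d) {M : ℕ}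
    (hM : 2 ≤ M) {X : Set (Site d)} (h0 : (0 : Site d) ∈ X) {N₀ : ℕ → ℕ}
    (hN : ∀ L, (trailWordsTo d L (0 : Site d)).card ≤ N₀ L) {R₁ R₂ : ℝ} (hR₁ : IsRemKernelConst d [M] X R₁)
    (hR₂ : IsRemKernelConst d [M - 1, 1] X R₂) :
    ∑' x, ∑ κ : Fin d × Bool, kdc 0 x * kdc x (stepVec κ) *
        (Letters.perc d p).T (.eq 1) (.ge 1) (.ge 1) (stepVec κ) x 0 ≤
      ENNReal.ofReal (bubbleSlotR p (nobleSup2 d p) 2 1 M N₀ R₁ R₂) := by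
  refine le_trans (ENNReal.tsum_le_tsum fun x => Finset.sum_le_sum fun κ _ => ?_)
    (tsum_sum_perc_T_eqOne_ge_ge_stepVec_le_ofReal p hd hp (m₂ := 1) (m₃ := 1) hM h0 hN hR₁ hR₂)
  calc kdc 0 x * kdc x (stepVec κ) * (Letters.perc d p).T (.eq 1) (.ge 1) (.ge 1) (stepVec κ) x 0
      ≤ 1 * 1 * (Letters.perc d p).T (.eq 1) (.ge 1) (.ge 1) (stepVec κ) x 0 := by
        gcongr
        · exact kdc_le_one 0 x
        · exact kdc_le_one x (stepVec κ)
    _ = _ := by rw [one_mul, one_mul]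

/-- **`(Ā^{ι}')_{0,0}` by EXL-XSLOT**: `(Ā^{ι}')_{0,0} ≤ bubbleSlotR p Γ̄₂ 2 1 M N₀ R₁ R₂` (closed counts; the primed
D74 element, landed closed form `matAbarIota'_zero_zero`).
[cite: FitznerVanDerHofstad2017, §6.1 case a = b = 0 (arXiv:1506.07977v2 p. 59); §5.1 "Elements of the bounds" (p. 49)]
[cite: FitznerVanDerHofstad2016NoBLE, §5.3.2 (5.40) (PTRF 169 (2017) p. 1098)] -/
theorem perc_matAbarIota'_zero_zero_le_xslot (hd : 2 ≤ d) (hp : p < criticalProbI d) {M : ℕ} (hM : 2 ≤ M)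
    {X : Set (Site d)} (h0 : (0 : Site d) ∈ X) {N₀ : ℕ → ℕ}
    (hN : ∀ L, (trailWordsTo d L (0 : Site d)).card ≤ N₀ L) {R₁ R₂ : ℝ} (hR₁ : IsRemKernelConst d [M] X R₁)
    (hR₂ : IsRemKernelConst d [M - 1, 1] X R₂) :
    matAbarIota' (Letters.perc d p) 0 0 ≤ ENNReal.ofReal (bubbleSlotR p (nobleSup2 d p) 2 1 M N₀ R₁ R₂) := by
  rw [matAbarIota'_zero_zero]
  exact perc_tsum_sum_kdc_kdc_T_eqOne_one_one_stepVec_le_xslot p hd hp hM h0 hN hR₁ hR₂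

/-- **`(Ā^{ι,*}')_{0,0}` by EXL-XSLOT**: the primed non-repulsive twin has the same closed form
(`matAbarIotaSt'_zero_zero`), hence the same majorant `bubbleSlotR p Γ̄₂ 2 1 M N₀ R₁ R₂`.
[cite: FitznerVanDerHofstad2017, §6.1 case a = b = 0 (arXiv:1506.07977v2 p. 59); §5.1 Table "Ā^{ι,a,b,*}" (p. 47)]
[cite: FitznerVanDerHofstad2016NoBLE, §5.3.2 (5.40) (PTRF 169 (2017) p. 1098)] -/
theorem perc_matAbarIotaSt'_zero_zero_le_xslot (hd : 2 ≤ d) (hp : p < criticalProbI d) {M : ℕ} (hM : 2 ≤ M)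
    {X : Set (Site d)} (h0 : (0 : Site d) ∈ X) {N₀ : ℕ → ℕ}
    (hN : ∀ L, (trailWordsTo d L (0 : Site d)).card ≤ N₀ L) {R₁ R₂ : ℝ} (hR₁ : IsRemKernelConst d [M] X R₁)
    (hR₂ : IsRemKernelConst d [M - 1, 1] X R₂) :
    matAbarIotaSt' (Letters.perc d p) 0 0 ≤ ENNReal.ofReal (bubbleSlotR p (nobleSup2 d p) 2 1 M N₀ R₁ R₂) := by
  rw [matAbarIotaSt'_zero_zero]
  exact perc_tsum_sum_kdc_kdc_T_eqOne_one_one_stepVec_le_xslot p hd hp hM h0 hN hR₁ hR₂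

/-- **`(A^{ι}')_{0,0}` by EXL-XSLOT**: `(A^{ι}')_{0,0} = (Ā^{ι}')_{0,0}` (landed `matAiota'_zero_zero_eq_matAbarIota'`),
hence `(A^{ι}')_{0,0} ≤ bubbleSlotR p Γ̄₂ 2 1 M N₀ R₁ R₂` — the cell-06 object of the `N = 0` chain.
[cite: FitznerVanDerHofstad2017, §6.1 case a = b = 0 (arXiv:1506.07977v2 p. 59); App. B Table B.4 row (0,0) (p. 75)]
[cite: FitznerVanDerHofstad2016NoBLE, §5.3.2 (5.40) (PTRF 169 (2017) p. 1098)] -/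
theorem perc_matAiota'_zero_zero_le_xslot (hd : 2 ≤ d) (hp : p < criticalProbI d) {M : ℕ} (hM : 2 ≤ M)
    {X : Set (Site d)} (h0 : (0 : Site d) ∈ X) {N₀ : ℕ → ℕ}
    (hN : ∀ L, (trailWordsTo d L (0 : Site d)).card ≤ N₀ L) {R₁ R₂ : ℝ} (hR₁ : IsRemKernelConst d [M] X R₁)
    (hR₂ : IsRemKernelConst d [M - 1, 1] X R₂) :
    matAiota' (Letters.perc d p) 0 0 ≤ ENNReal.ofReal (bubbleSlotR p (nobleSup2 d p) 2 1 M N₀ R₁ R₂) := by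
  rw [matAiota'_zero_zero_eq_matAbarIota']
  exact perc_matAbarIota'_zero_zero_le_xslot p hd hp hM h0 hN hR₁ hR₂

/-- **`(A^{ι,*}')_{0,0}` by EXL-XSLOT**: `(A^{ι,*}')_{0,0} = (A^{ι}')_{0,0}` (landed `matAiotaSt'_zero_zero_eq_matAiota'`).
[cite: FitznerVanDerHofstad2017, §6.1 case a = b = 0 (arXiv:1506.07977v2 p. 59); App. B, sentence after Table B.4 (p. 75)]
[cite: FitznerVanDerHofstad2016NoBLE, §5.3.2 (5.40) (PTRF 169 (2017) p. 1098)] -/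
theorem perc_matAiotaSt'_zero_zero_le_xslot (hd : 2 ≤ d) (hp : p < criticalProbI d) {M : ℕ} (hM : 2 ≤ M)
    {X : Set (Site d)} (h0 : (0 : Site d) ∈ X) {N₀ : ℕ → ℕ}
    (hN : ∀ L, (trailWordsTo d L (0 : Site d)).card ≤ N₀ L) {R₁ R₂ : ℝ} (hR₁ : IsRemKernelConst d [M] X R₁)
    (hR₂ : IsRemKernelConst d [M - 1, 1] X R₂) :
    matAiotaSt' (Letters.perc d p) 0 0 ≤ ENNReal.ofReal (bubbleSlotR p (nobleSup2 d p) 2 1 M N₀ R₁ R₂) := by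
  rw [matAiotaSt'_zero_zero_eq_matAiota']
  exact perc_matAiota'_zero_zero_le_xslot p hd hp hM h0 hN hR₁ hR₂

/-- **`(A^ι)_{1,0}` by EXL-XSLOT**: `(A^ι)_{1,0} = Σ'_x Σ_κ (1−δ_{x,0}) 𝓣_{1̲,1,0}(e_κ,x,e_{ι₀}) ≤ bubbleSlotR p Γ̄₂ 2 0 M
N R₁ R₂` at the unit class (`N` majorises the trail-word counts to `e_{ι₀}`, `R₁` valid for `[M]`, `R₂` for `[M, 0]`
on a set containing `e_{ι₀}`; `1 ≤ M`) — no peel, no `2d·p` prefactor: the exact bond is the first slot of the trail.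
[cite: FitznerVanDerHofstad2017, App. B Table B.4 row (1,0) (arXiv:1506.07977v2 p. 74); (5.1) p. 49]
[cite: FitznerVanDerHofstad2016NoBLE, §5.3.2 (5.40) (PTRF 169 (2017) p. 1098)] -/
theorem perc_matAiota_one_zero_le_xslot (hd : 2 ≤ d) (hp : p < criticalProbI d) {M : ℕ} (hM : 1 ≤ M)
    (ι₀ : Fin d × Bool) {X : Set (Site d)} (hι : (stepVec ι₀ : Site d) ∈ X) {N : ℕ → ℕ}
    (hN : ∀ L, (trailWordsTo d L (stepVec ι₀ : Site d)).card ≤ N L) {R₁ R₂ : ℝ}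
    (hR₁ : IsRemKernelConst d [M] X R₁) (hR₂ : IsRemKernelConst d [M, 0] X R₂) :
    matAiota (Letters.perc d p) 1 0 ≤ ENNReal.ofReal (bubbleSlotR p (nobleSup2 d p) 2 0 M N R₁ R₂) := by
  rw [perc_matAiota_one_zero p ι₀]
  refine le_trans (ENNReal.tsum_le_tsum fun x => Finset.sum_le_sum fun κ _ => ?_)
    (tsum_sum_perc_T_eqOne_ge_ge_stepVec_le_ofReal p hd hp (m₂ := 1) (m₃ := 0) hM hι hN hR₁ hR₂)
  calc kdc x 0 * (Letters.perc d p).T (.eq 1) (.ge 1) (.ge 0) (stepVec κ) x (stepVec ι₀)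
      ≤ 1 * (Letters.perc d p).T (.eq 1) (.ge 1) (.ge 0) (stepVec κ) x (stepVec ι₀) := by
        gcongr
        exact kdc_le_one x 0
    _ = _ := one_mul _

end Cells

end Literature.Probability.FitznerVanDerHofstad2017.NobleBlocks
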